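import Literature.AnabelianGeometry.SemiGraphs.RelativeGluedCoverings
import Literature.AnabelianGeometry.SemiGraphs.TemperedVerticialDistinct

/-!
# Non-vacuity witnesses for [SemiAnbd] interface records with no producer, II (NV-L3 batch 2, abc-iut cell)

Second anti-vacuity companion (layer L3, row family «NV-L3/<Interface>», seat abc-iut-w4-d082 gen 3) to the
INHABITATION-CENSUS-L3-v1 of abc-iut-w4-d098, for records left unclaimed after the first wave: `ProfiniteSemiGraph.Approximator.MixedSpec`
(the specification of the covering `G''` in the proof of [SemiAnbd] Prop. 2.6, p. 28) and
`ProfiniteSemiGraph.Approximator.RelGluingData` (relative gluing data, Cor. 2.7 p. 30).  Mochizuki, *Semi-graphs of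
anabelioids*, Publ. RIMS **42** (2006) [cite: MochizukiSemiAnbd2006, Prop 2.6 p.28].  PROOF-ONLY
(0 definitions); both theorems are `Nonempty …` statements labelled HONESTLY:

* `_degenerate` — the EMPTY-covering specification / gluing data (all multiplicities `0`, empty
  fibres over the distinguished locus): it inhabits the record and asserts nothing; never to be cited
  as evidence beyond «the type is inhabited».

A zero row of the census is «not yet witnessed», not «vacuous».  Nothing here asserts a result of the
paper; nothing here bears on [IUTchIII] Cor. 3.12.
-/

namespace Literature.AnabelianGeometry.SemiGraphs

open CategoryTheory

universe u

namespace ProfiniteSemiGraph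

namespace Approximator

variable {𝒢 : ProfiniteSemiGraph.{u}} (A : 𝒢.Approximator)

/-! ### [SemiAnbd] Prop 2.6 p.28: specifications of the covering `G''` -/

/-- **`MixedSpec` is inhabited at EVERY approximator (`_degenerate`, the EMPTY covering)**: all
multiplicities `a_w = a'_w = k_e = 0` and `N_w := Π'_w`; the freeness clause is vacuous (`0 < 0` is
false) and the cardinality clause reads `0 = 0`.  This is the specification of the empty object of
`B(𝒢)`; it inhabits the record and asserts nothing about elevated vertices.
[cite: MochizukiSemiAnbd2006, Prop 2.6 p.28] -/
theorem MixedSpec.nonempty_degenerate : Nonempty A.MixedSpec :=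
  ⟨{ Nf := fun _ => ⊤
     a := fun _ => 0
     a' := fun _ => 0
     k := fun _ => 0
     free := fun _ _ _ _ h => absurd h (lt_irrefl 0)
     card := fun _ _ _ => by simp }⟩

/-! ### [SemiAnbd] Cor 2.7 p.30: relative gluing data -/

/-- **`RelGluingData` is inhabited at EVERY approximator and base covering (`_degenerate`)**: the
absolute gluing data of the empty specification (`MixedSpec.toGluingData`, edge fibres
`Π'_e-set × Fin 0 = ∅`), EMPTY fibres over the distinguished locus (so the freeness clause is vacuous
and the cardinality clause reads `0 = 0`), and the empty distinguished subsets.  Asserts nothing.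
[cite: MochizukiSemiAnbd2006, Cor 2.7 p.30] -/
theorem RelGluingData.nonempty_degenerate (S₀ : CovObj 𝒢) : Nonempty (A.RelGluingData S₀) := by
  classical
  let σ₀ : A.MixedSpec :=
    { Nf := fun _ => ⊤, a := fun _ => 0, a' := fun _ => 0, k := fun _ => 0,
      free := fun _ _ _ _ h => absurd h (lt_irrefl 0), card := fun _ _ _ => by simp }
  refine ⟨{ D := σ₀.toGluingData
            XO := fun _ => PEmpty.{u + 1}
            actO := fun _ => { smul := fun _ x => x, one_smul := fun x => rfl,
                               mul_smul := fun _ _ x => rfl }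
            finiteO := fun _ => inferInstance
            free_O := fun _ _ _ _ _ x => x.elim
            card_O := fun b w _ => ?_
            O := fun _ => ∅
            O_inv := fun _ _ _ => by simp }⟩
  change Nat.card (A.FE (𝒢.graph.edgeOf b) × Fin (σ₀.k (𝒢.graph.edgeOf b))) = Nat.card PEmpty.{u + 1}
  simp [σ₀]

end Approximator

end ProfiniteSemiGraph


end Literature.AnabelianGeometry.SemiGraphs
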